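import Summits.ValiantsHypothesis.ValiantsHypothesis.Theses.RealTau
import Literature.Computability.AlgebraicComplexity.RealTauKnownCases
import Summits.ValiantsHypothesis.ValiantsHypothesis.Theorems.RealTauRealTauRefinedStubWaringSmallK

/-!
# Crux `RealTau.RealTauRefined` (stmt-ValiantsHypothesis-18101), line `fischer-powers` —
# the open core `stub_waringCore` holds for every FIXED number `K` of powers, uniformly in `m`

The sole open stub `stub_waringCore` asks for ONE `a` with `#roots(Σ_{i<K} ε_i h_i^m) ≤
2^(a(m+1)) (K+T+2)^a` for `T`-sparse linear forms `h_i` in common monomials; its content is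
UNIFORMITY IN `K`.  This file proves the swap `∀ K, ∃ a(K)` in the strong, `m`-FREE form
`#roots ≤ (T + 3)^(5^K)` (`waring_card_roots_le_fixedK`) by the Rolle–Wronskian cascade: the engine
`cascade_card_roots_le` bounds the zeros of a nonzero `Σ_{i<K} h_i^n w_i` (`T`-sparse `h_i`,
`S`-sparse cofactors `w_i`, ANY `n`) by `(T+S+2)^(5^K)`, one step trading `(K+1, n, S)` for
`(K, n-1, 4T²S²)` via `W(h^(n+1) w, g^(n+1) v) = h^n g^n ((n+1) w v W(h,g) + h g W(w,v))` and Rolle in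
quotient form `#roots F ≤ 2 #roots g + #roots W(g,F) + 1`.  With `∀ m ∃ a`, `∀ T ∃ a` (Descartes,
`Theorems/RealTauRefined/Negative/LoadBearing.lean`) this leaves `∃ a ∀ K m T` — the crux — as the
only open quantifier order.  (Koiran–Portier–Tavenas, J. Symb. Comput. 68 (2015) Thm. 12 get
`T^{O(K³)}` from one `K × K` Wronskian; either way exponential in `K`, useless after Fischer's
`K = k 2^m`: a calibration theorem, landed `--supports`.)
-/
noncomputable section

-- single-conjunct layout: Sub = Summit, duplicated namespace component intended
set_option linter.dupNamespace false

namespace Summit.ValiantsHypothesis.ValiantsHypothesis.Theorems.RealTauRealTauRefined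

open Polynomial Finset
open Literature.Computability.AlgebraicComplexity

/-- Differentiation does not increase the number of monomials. [folklore] -/
theorem card_support_derivative_le (p : ℝ[X]) :
    (derivative p).support.card ≤ p.support.card :=
  Finset.card_le_card_of_injOn (· + 1) (fun _ hn => mem_support_derivative.mp hn)
    (fun a _ b _ h => by simpa using h)

/-- The Wronskian `W(a,b) = a b' - a' b` of an `A`-sparse and a `B`-sparse polynomial has at most
`2 A B` monomials. [folklore] -/
theorem card_support_wronskian_le (a b : ℝ[X]) :
    (wronskian a b).support.card ≤ 2 * (a.support.card * b.support.card) := by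
  rw [wronskian, sub_eq_add_neg]
  calc (a * derivative b + -(derivative a * b)).support.card
      ≤ (a * derivative b).support.card + (-(derivative a * b)).support.card :=
        (card_le_card support_add).trans (card_union_le _ _)
    _ ≤ a.support.card * (derivative b).support.card +
          (derivative a).support.card * b.support.card := by
        rw [support_neg]
        exact Nat.add_le_add card_support_mul_le card_support_mul_le
    _ ≤ a.support.card * b.support.card + a.support.card * b.support.card :=
        Nat.add_le_add (Nat.mul_le_mul_left _ (card_support_derivative_le b))
          (Nat.mul_le_mul_right _ (card_support_derivative_le a))
    _ = 2 * (a.support.card * b.support.card) := by ring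

/-- Distinct real zeros of a `T`-sparse polynomial: at most `2 T` (Descartes, tree
`card_roots_toFinset_le_of_card_support`; vacuous bound `0` for the zero polynomial is fine). -/
theorem card_roots_le_two_mul_card_support (p : ℝ[X]) :
    p.roots.toFinset.card ≤ 2 * p.support.card := by
  rcases eq_or_ne p 0 with rfl | hp
  · simp
  · have h := card_roots_toFinset_le_of_card_support hp
    have h1 : 0 < p.support.card :=
      card_pos.mpr (nonempty_iff_ne_empty.mpr (mt support_eq_empty.mp hp))
    omega

/-- Distinct zeros of a product lie among those of the factors. [folklore] -/
theorem card_roots_toFinset_mul_le (p q : ℝ[X]) :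
    (p * q).roots.toFinset.card ≤ p.roots.toFinset.card + q.roots.toFinset.card := by
  classical
  rcases eq_or_ne (p * q) 0 with h0 | h0
  · rw [h0, roots_zero, Multiset.toFinset_zero, card_empty]; exact Nat.zero_le _
  · rw [roots_mul h0, Multiset.toFinset_add]
    exact card_union_le _ _

/-- Distinct zeros of a power are those of the base (none recorded for `p ^ 0 = 1`). [folklore] -/
theorem card_roots_toFinset_pow_le (p : ℝ[X]) (n : ℕ) :
    (p ^ n).roots.toFinset.card ≤ p.roots.toFinset.card := by
  classical
  rcases Nat.eq_zero_or_pos n with rfl | hn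
  · simp
  · rw [roots_pow, Multiset.toFinset_nsmul _ _ hn.ne']

/-- **Rolle in quotient form.** For nonzero real polynomials `F, g`:
`#roots F ≤ 2 · #roots g + #roots W(g, F) + 1`, where `W(g,F) = g F' - g' F`.
Proof: the roots of `F` at which `g ≠ 0`, taken consecutively, are interleaved with the roots of
`g` and of `W(g,F)` (Rolle for `F/g` on a root-free interval of `g`; if `W(g,F) = 0` then `F/g` is
constant there, forcing `F = 0`); the remaining roots of `F` are roots of `g`. [folklore] -/
theorem card_roots_le_rolle_wronskian (F g : ℝ[X]) (hF : F ≠ 0) (hg : g ≠ 0) :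
    F.roots.toFinset.card ≤
      2 * g.roots.toFinset.card + (wronskian g F).roots.toFinset.card + 1 := by
  classical
  set s := F.roots.toFinset.filter (fun x => g.eval x ≠ 0) with hs
  set t := g.roots.toFinset ∪ (wronskian g F).roots.toFinset with ht
  -- (1) the roots of `F` off the zero set of `g` are interleaved with `t`
  have hinter : s.card ≤ t.card + 1 := by
    refine Finset.card_le_of_interleaved fun x hx y hy hxy hgap => ?_
    rw [hs, mem_filter, Multiset.mem_toFinset, mem_roots hF] at hx hy
    by_cases hgz : ∃ z, x < z ∧ z < y ∧ g.eval z = 0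
    · obtain ⟨z, hxz, hzy, hz⟩ := hgz
      exact ⟨z, mem_union_left _ (Multiset.mem_toFinset.mpr ((mem_roots hg).mpr hz)), hxz, hzy⟩
    · push Not at hgz
      -- `g ≠ 0` on `[x, y]`
      have hgI : ∀ z ∈ Set.Icc x y, g.eval z ≠ 0 := by
        intro z hz
        rcases hz.1.eq_or_lt with rfl | hxz
        · exact hx.2
        rcases hz.2.eq_or_lt with rfl | hzy
        · exact hy.2
        exact hgz z hxz hzy
      -- Rolle for `φ = F / g` on `[x, y]`
      set φ : ℝ → ℝ := fun z => F.eval z / g.eval z with hφ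
      have hderiv : ∀ z, g.eval z ≠ 0 → HasDerivAt φ
          (((derivative F).eval z * g.eval z - F.eval z * (derivative g).eval z) / (g.eval z) ^ 2) z := by
        intro z hz
        exact (F.hasDerivAt z).div (g.hasDerivAt z) hz
      have hcont : ContinuousOn φ (Set.Icc x y) := fun z hz =>
        (hderiv z (hgI z hz)).continuousAt.continuousWithinAt
      have hφx : φ x = 0 := by simp [hφ, hx.1.eq_zero]
      have hφy : φ y = 0 := by simp [hφ, hy.1.eq_zero]
      obtain ⟨c, hc, hc0⟩ := exists_deriv_eq_zero hxy hcont (hφx.trans hφy.symm)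
      have hgc : g.eval c ≠ 0 := hgI c (Set.Ioo_subset_Icc_self hc)
      have hWc : (wronskian g F).eval c = 0 := by
        have h1 := (hderiv c hgc).deriv
        rw [hc0] at h1
        have h2 : (derivative F).eval c * g.eval c - F.eval c * (derivative g).eval c = 0 := by
          rcases div_eq_zero_iff.mp h1.symm with h | h
          · exact h
          · exact absurd (pow_eq_zero_iff two_ne_zero |>.mp h) hgc
        rw [wronskian, eval_sub, eval_mul, eval_mul]
        linarith
      by_cases hW : wronskian g F = 0
      · -- then `φ` is constant on `[x, y]`, so `F` vanishes on `[x, y]`: impossible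
        exfalso
        have hderiv0 : ∀ z ∈ Set.Icc x y, HasDerivAt φ 0 z := by
          intro z hz
          have h1 := hderiv z (hgI z hz)
          have hnum : (derivative F).eval z * g.eval z - F.eval z * (derivative g).eval z = 0 := by
            have : (wronskian g F).eval z = 0 := by rw [hW, eval_zero]
            rw [wronskian, eval_sub, eval_mul, eval_mul] at this
            linarith
          rwa [hnum, zero_div] at h1
        have hconst : ∀ z ∈ Set.Icc x y, φ z = φ x :=
          constant_of_has_deriv_right_zero hcont
            (fun z hz => (hderiv0 z (Set.Ico_subset_Icc_self hz)).hasDerivWithinAt)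
        apply hF
        refine eq_zero_of_infinite_isRoot F ((Set.Icc_infinite hxy).mono fun z hz => ?_)
        have h1 : φ z = 0 := (hconst z hz).trans hφx
        have h2 : F.eval z / g.eval z = 0 := h1
        rcases div_eq_zero_iff.mp h2 with h | h
        · exact h
        · exact absurd h (hgI z hz)
      · exact ⟨c, mem_union_right _ (Multiset.mem_toFinset.mpr ((mem_roots hW).mpr hWc)), hc.1, hc.2⟩
  -- (2) the other roots of `F` are roots of `g`
  have hsplit : F.roots.toFinset ⊆ s ∪ g.roots.toFinset := by
    intro x hx
    by_cases hgx : g.eval x = 0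
    · exact mem_union_right _ (Multiset.mem_toFinset.mpr ((mem_roots hg).mpr hgx))
    · exact mem_union_left _ (mem_filter.mpr ⟨hx, hgx⟩)
  calc F.roots.toFinset.card ≤ (s ∪ g.roots.toFinset).card := card_le_card hsplit
    _ ≤ s.card + g.roots.toFinset.card := card_union_le _ _
    _ ≤ (t.card + 1) + g.roots.toFinset.card := Nat.add_le_add_right hinter _
    _ ≤ (g.roots.toFinset.card + (wronskian g F).roots.toFinset.card + 1) +
          g.roots.toFinset.card := by
        have ht' : t.card ≤ g.roots.toFinset.card + (wronskian g F).roots.toFinset.card :=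
          card_union_le _ _
        omega
    _ = 2 * g.roots.toFinset.card + (wronskian g F).roots.toFinset.card + 1 := by ring

/-- **Cascade identity.** `W(h^(n+1) w, g^(n+1) v) = h^n · (g^n · ((n+1) w v W(h,g) + h g W(w,v)))`:
after dividing a sum of `(n+1)`-st powers with cofactors by its last term and differentiating, the
numerator is again a sum of `n`-th powers with (less sparse) cofactors. [folklore] -/
theorem wronskian_pow_succ_mul (h w g v : ℝ[X]) (n : ℕ) :
    wronskian (h ^ (n + 1) * w) (g ^ (n + 1) * v) =
      h ^ n * (g ^ n * (C ((n : ℝ) + 1) * (w * v * wronskian h g) + h * g * wronskian w v)) := by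
  simp only [wronskian, derivative_mul, derivative_pow_succ]
  ring

/-- The new cofactor `(n+1) w v W(h,g) + h g W(w,v)` has at most `4 T² S²` monomials. -/
theorem card_support_cofactor_le {T S : ℕ} (h w g v : ℝ[X]) (n : ℕ)
    (hh : h.support.card ≤ T) (hg : g.support.card ≤ T) (hw : w.support.card ≤ S)
    (hv : v.support.card ≤ S) :
    (C ((n : ℝ) + 1) * (w * v * wronskian h g) + h * g * wronskian w v).support.card
      ≤ 4 * T ^ 2 * S ^ 2 := by
  have h1 : (C ((n : ℝ) + 1) * (w * v * wronskian h g)).support.card ≤ S * S * (2 * (T * T)) :=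
    calc (C ((n : ℝ) + 1) * (w * v * wronskian h g)).support.card
        ≤ (w * v * wronskian h g).support.card := by
          rw [C_mul']
          exact card_le_card (support_smul _ _)
      _ ≤ (w * v).support.card * (wronskian h g).support.card := card_support_mul_le
      _ ≤ (w.support.card * v.support.card) * (2 * (h.support.card * g.support.card)) :=
          Nat.mul_le_mul card_support_mul_le (card_support_wronskian_le h g)
      _ ≤ S * S * (2 * (T * T)) :=
          Nat.mul_le_mul (Nat.mul_le_mul hw hv) (Nat.mul_le_mul_left 2 (Nat.mul_le_mul hh hg))
  have h2 : (h * g * wronskian w v).support.card ≤ T * T * (2 * (S * S)) :=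
    calc (h * g * wronskian w v).support.card
        ≤ (h * g).support.card * (wronskian w v).support.card := card_support_mul_le
      _ ≤ (h.support.card * g.support.card) * (2 * (w.support.card * v.support.card)) :=
          Nat.mul_le_mul card_support_mul_le (card_support_wronskian_le w v)
      _ ≤ T * T * (2 * (S * S)) :=
          Nat.mul_le_mul (Nat.mul_le_mul hh hg) (Nat.mul_le_mul_left 2 (Nat.mul_le_mul hw hv))
  calc _ ≤ (C ((n : ℝ) + 1) * (w * v * wronskian h g)).support.card +
          (h * g * wronskian w v).support.card :=
        (card_le_card support_add).trans (card_union_le _ _)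
    _ ≤ S * S * (2 * (T * T)) + T * T * (2 * (S * S)) := Nat.add_le_add h1 h2
    _ = 4 * T ^ 2 * S ^ 2 := by ring

/-- One cascade step fits in the budget: `6T + 4S + 1 + (T + 4T²S² + 2)^(5^K) + 2T ≤ (T+S+2)^(5^(K+1))`. -/
theorem cascade_budget (K T S : ℕ) :
    2 * (2 * T + 2 * S) + ((2 * T) + (T + 4 * T ^ 2 * S ^ 2 + 2) ^ (5 ^ K)) + 1
      ≤ (T + S + 2) ^ (5 ^ (K + 1)) := by
  set B := T + S + 2 with hB
  have hB2 : 2 ≤ B := by omega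
  have hc : 1 ≤ 5 ^ K := Nat.one_le_pow _ _ (by norm_num)
  have hinner : T + 4 * T ^ 2 * S ^ 2 + 2 ≤ B ^ 4 := by
    have h1 : 2 * T * S + T + 2 ≤ B ^ 2 := by rw [hB]; nlinarith
    calc T + 4 * T ^ 2 * S ^ 2 + 2 ≤ (2 * T * S + T + 2) ^ 2 := by nlinarith
      _ ≤ (B ^ 2) ^ 2 := Nat.pow_le_pow_left h1 2
      _ = B ^ 4 := (pow_mul B 2 2).symm
  have hpow : (T + 4 * T ^ 2 * S ^ 2 + 2) ^ (5 ^ K) ≤ B ^ (4 * 5 ^ K) := by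
    calc (T + 4 * T ^ 2 * S ^ 2 + 2) ^ (5 ^ K) ≤ (B ^ 4) ^ (5 ^ K) := Nat.pow_le_pow_left hinner _
      _ = B ^ (4 * 5 ^ K) := by rw [← pow_mul]
  have hlin : 2 * (2 * T + 2 * S) + 2 * T + 1 ≤ B ^ 4 := by
    have h8 : 8 ≤ B ^ 3 := le_trans (by norm_num) (Nat.pow_le_pow_left hB2 3)
    calc 2 * (2 * T + 2 * S) + 2 * T + 1 ≤ 8 * B := by rw [hB]; omega
      _ ≤ B ^ 3 * B := Nat.mul_le_mul_right B h8
      _ = B ^ 4 := by ring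
  have hlin' : 2 * (2 * T + 2 * S) + 2 * T + 1 ≤ B ^ (4 * 5 ^ K) :=
    hlin.trans (Nat.pow_le_pow_right (by omega) (by omega))
  have hkey : B ^ (4 * 5 ^ K) + B ^ (4 * 5 ^ K) ≤ B ^ (5 ^ (K + 1)) := by
    have h1 : B ^ (5 ^ (K + 1)) = B ^ (4 * 5 ^ K) * B ^ (5 ^ K) := by
      rw [← pow_add]; congr 1; rw [pow_succ]; ring
    have h2 : 2 ≤ B ^ (5 ^ K) := le_trans hB2 (Nat.le_self_pow (pow_ne_zero K (by norm_num)) B)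
    calc B ^ (4 * 5 ^ K) + B ^ (4 * 5 ^ K) = B ^ (4 * 5 ^ K) * 2 := by ring
      _ ≤ B ^ (4 * 5 ^ K) * B ^ (5 ^ K) := Nat.mul_le_mul_left _ h2
      _ = B ^ (5 ^ (K + 1)) := h1.symm
  calc 2 * (2 * T + 2 * S) + ((2 * T) + (T + 4 * T ^ 2 * S ^ 2 + 2) ^ (5 ^ K)) + 1
      = (2 * (2 * T + 2 * S) + 2 * T + 1) + (T + 4 * T ^ 2 * S ^ 2 + 2) ^ (5 ^ K) := by ring
    _ ≤ B ^ (4 * 5 ^ K) + B ^ (4 * 5 ^ K) := Nat.add_le_add hlin' hpow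
    _ ≤ B ^ (5 ^ (K + 1)) := hkey

/-- The Descartes bottom of the cascade fits in the budget: `2 (K+1) S ≤ (T+S+2)^(5^(K+1))`. -/
theorem descartes_budget (K T S : ℕ) : 2 * ((K + 1) * S) ≤ (T + S + 2) ^ (5 ^ (K + 1)) := by
  set B := T + S + 2 with hB
  have hB2 : 2 ≤ B := by omega
  have hS : S ≤ B := by omega
  have h1 : 2 * (K + 1) ≤ 2 ^ (K + 1) := by
    have := Nat.lt_two_pow_self (n := K)
    rw [pow_succ]; omega
  have h2 : 2 ^ (K + 1) ≤ B ^ (K + 1) := Nat.pow_le_pow_left hB2 _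
  have h3 : K + 2 ≤ 5 ^ (K + 1) := Nat.succ_le_of_lt (Nat.lt_pow_self (by norm_num))
  calc 2 * ((K + 1) * S) = (2 * (K + 1)) * S := by ring
    _ ≤ B ^ (K + 1) * B := Nat.mul_le_mul (h1.trans h2) hS
    _ = B ^ (K + 2) := by ring
    _ ≤ B ^ (5 ^ (K + 1)) := Nat.pow_le_pow_right (by omega) h3

/-- **Rolle–Wronskian cascade (fixed number of terms, uniform in the exponent).** For every `K`,
every exponent `n`, real `T`-sparse `h_i` and `S`-sparse cofactors `w_i` (`i < K`): if
`F = Σ_{i<K} h_i^n w_i ≠ 0` then `F` has at most `(T + S + 2)^(5^K)` distinct real zeros.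
Induction on `K`: write `F = F₀ + g`, `g = h_K^n w_K` the last term; if `g = 0` use the hypothesis
for `F₀`; if `n = 0`, Descartes (`≤ K S` monomials); otherwise Rolle in quotient form
(`card_roots_le_rolle_wronskian`) gives `#roots F ≤ 2 #roots g + #roots W(g,F) + 1`, and by
`wronskian_pow_succ_mul` `W(g,F) = h_K^(n-1) · Σ_{i<K} h_i^(n-1) v_i` with `4T²S²`-sparse `v_i`
(`card_support_cofactor_le`), to which the induction hypothesis applies with exponent `n-1`.
[folklore; the Wronskian method of Koiran–Portier–Tavenas 2015 in sequential form] -/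
theorem cascade_card_roots_le (K : ℕ) :
    ∀ (n T S : ℕ) (h w : Fin K → ℝ[X]), (∀ i, (h i).support.card ≤ T) →
      (∀ i, (w i).support.card ≤ S) → (∑ i, h i ^ n * w i) ≠ 0 →
        (∑ i, h i ^ n * w i).roots.toFinset.card ≤ (T + S + 2) ^ (5 ^ K) := by
  classical
  induction K with
  | zero =>
    intro n T S h w _ _ hF
    simp at hF
  | succ K ih =>
    intro n T S h w hh hw hF
    -- split off the last term
    set h' : Fin K → ℝ[X] := fun i => h i.castSucc with hh'
    set w' : Fin K → ℝ[X] := fun i => w i.castSucc with hw'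
    set hL := h (Fin.last K) with hhL
    set wL := w (Fin.last K) with hwL
    have hsplit : (∑ i, h i ^ n * w i) = (∑ i, h' i ^ n * w' i) + hL ^ n * wL :=
      Fin.sum_univ_castSucc _
    have hh'T : ∀ i, (h' i).support.card ≤ T := fun i => hh _
    have hw'S : ∀ i, (w' i).support.card ≤ S := fun i => hw _
    have hmono : (T + S + 2) ^ (5 ^ K) ≤ (T + S + 2) ^ (5 ^ (K + 1)) :=
      Nat.pow_le_pow_right (by omega) (Nat.pow_le_pow_right (by norm_num) (Nat.le_succ K))
    -- exponent zero: Descartes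
    rcases Nat.eq_zero_or_pos n with rfl | hn
    · have hsupp : (∑ i, h i ^ 0 * w i).support.card ≤ (K + 1) * S := by
        calc (∑ i, h i ^ 0 * w i).support.card ≤ ∑ i, (h i ^ 0 * w i).support.card :=
              card_support_sum_le _ _
          _ ≤ ∑ _i : Fin (K + 1), S := sum_le_sum fun i _ => by rw [pow_zero, one_mul]; exact hw i
          _ = (K + 1) * S := by simp
      calc (∑ i, h i ^ 0 * w i).roots.toFinset.card ≤ 2 * (∑ i, h i ^ 0 * w i).support.card :=
            card_roots_le_two_mul_card_support _
        _ ≤ 2 * ((K + 1) * S) := Nat.mul_le_mul_left 2 hsupp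
        _ ≤ (T + S + 2) ^ (5 ^ (K + 1)) := descartes_budget K T S
    obtain ⟨n', rfl⟩ : ∃ n', n = n' + 1 := ⟨n - 1, by omega⟩
    -- the last term
    set g := hL ^ (n' + 1) * wL with hgdef
    by_cases hg0 : g = 0
    · -- `F = F₀`
      have hF0 : (∑ i, h' i ^ (n' + 1) * w' i) ≠ 0 := by
        intro h0; apply hF; rw [hsplit, h0, hg0, add_zero]
      rw [hsplit, hg0, add_zero]
      exact (ih (n' + 1) T S h' w' hh'T hw'S hF0).trans hmono
    -- `g ≠ 0`: Rolle in quotient form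
    have hL0 : hL ≠ 0 := by
      intro h0; apply hg0; rw [hgdef, h0, zero_pow (Nat.succ_ne_zero _), zero_mul]
    have hwL0 : wL ≠ 0 := by
      intro h0; apply hg0; rw [hgdef, h0, mul_zero]
    have hZg : g.roots.toFinset.card ≤ 2 * T + 2 * S :=
      calc g.roots.toFinset.card ≤ (hL ^ (n' + 1)).roots.toFinset.card + wL.roots.toFinset.card :=
            card_roots_toFinset_mul_le _ _
        _ ≤ hL.roots.toFinset.card + wL.roots.toFinset.card :=
            Nat.add_le_add_right (card_roots_toFinset_pow_le _ _) _
        _ ≤ 2 * (hL).support.card + 2 * wL.support.card :=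
            Nat.add_le_add (card_roots_le_two_mul_card_support _)
              (card_roots_le_two_mul_card_support _)
        _ ≤ 2 * T + 2 * S := Nat.add_le_add (Nat.mul_le_mul_left 2 (hh _))
              (Nat.mul_le_mul_left 2 (hw _))
    -- the Wronskian `W(g, F) = hL^n' · F₁`, `F₁` a sum of `n'`-th powers with new cofactors
    set v : Fin K → ℝ[X] := fun i =>
      C ((n' : ℝ) + 1) * (wL * w' i * wronskian hL (h' i)) + hL * h' i * wronskian wL (w' i) with hv
    have hvS : ∀ i, (v i).support.card ≤ 4 * T ^ 2 * S ^ 2 := fun i =>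
      card_support_cofactor_le hL wL (h' i) (w' i) n' (hh _) (hh _) (hw _) (hw _)
    have hWeq : wronskian g (∑ i, h i ^ (n' + 1) * w i) = hL ^ n' * ∑ i, h' i ^ n' * v i := by
      rw [hsplit, wronskian_add_right, wronskian_self_eq_zero, add_zero, ← wronskianBilin_apply,
        map_sum, mul_sum]
      refine sum_congr rfl fun i _ => ?_
      rw [wronskianBilin_apply, hgdef, wronskian_pow_succ_mul, hv]
    have hZW : (wronskian g (∑ i, h i ^ (n' + 1) * w i)).roots.toFinset.card ≤
        2 * T + (T + 4 * T ^ 2 * S ^ 2 + 2) ^ (5 ^ K) := by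
      by_cases hF1 : (∑ i, h' i ^ n' * v i) = 0
      · rw [hWeq, hF1, mul_zero, roots_zero, Multiset.toFinset_zero, card_empty]
        exact Nat.zero_le _
      · rw [hWeq]
        calc (hL ^ n' * ∑ i, h' i ^ n' * v i).roots.toFinset.card
            ≤ (hL ^ n').roots.toFinset.card + (∑ i, h' i ^ n' * v i).roots.toFinset.card :=
              card_roots_toFinset_mul_le _ _
          _ ≤ 2 * T + (T + 4 * T ^ 2 * S ^ 2 + 2) ^ (5 ^ K) := by
              refine Nat.add_le_add ?_ (ih n' T (4 * T ^ 2 * S ^ 2) h' v hh'T hvS hF1)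
              exact (card_roots_toFinset_pow_le _ _).trans
                ((card_roots_le_two_mul_card_support _).trans (Nat.mul_le_mul_left 2 (hh _)))
    calc (∑ i, h i ^ (n' + 1) * w i).roots.toFinset.card
        ≤ 2 * g.roots.toFinset.card +
            (wronskian g (∑ i, h i ^ (n' + 1) * w i)).roots.toFinset.card + 1 :=
          card_roots_le_rolle_wronskian _ g hF hg0
      _ ≤ 2 * (2 * T + 2 * S) + ((2 * T) + (T + 4 * T ^ 2 * S ^ 2 + 2) ^ (5 ^ K)) + 1 := by
          have := Nat.mul_le_mul_left 2 hZg
          omega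
      _ ≤ (T + S + 2) ^ (5 ^ (K + 1)) := cascade_budget K T S

/-- **`stub_waringCore` for each fixed `K`, uniformly in `m` (m-FREE bound).** For every `K`,
every `m`, real coefficients `ε : Fin K → ℝ`, `c : K × T` and exponents `e` (no monotonicity
needed), the Waring-on-curve sum `G = Σ_{i<K} ε_i (Σ_l c_il X^(e_l))^m`, if nonzero, has at most
`(T + 3)^(5^K)` distinct real zeros — a bound independent of `m`.
[folklore; cf. Koiran–Portier–Tavenas, J. Symb. Comput. 68 (2015), Thm. 12 (`T^{O(K³)}`)] -/
theorem waring_card_roots_le_fixedK (K m T : ℕ) (ε : Fin K → ℝ) (c : Fin K → Fin T → ℝ)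
    (e : Fin T → ℕ) (hG : (∑ i, C (ε i) * (∑ l, C (c i l) * X ^ (e l)) ^ m) ≠ 0) :
    (∑ i, C (ε i) * (∑ l, C (c i l) * X ^ (e l)) ^ m).roots.toFinset.card ≤ (T + 3) ^ (5 ^ K) := by
  have hcomm : (∑ i, C (ε i) * (∑ l, C (c i l) * X ^ (e l)) ^ m) =
      ∑ i, (∑ l, C (c i l) * X ^ (e l)) ^ m * C (ε i) :=
    sum_congr rfl fun i _ => mul_comm _ _
  rw [hcomm] at hG ⊢
  have h1 := cascade_card_roots_le K m T 1 (fun i => ∑ l, C (c i l) * X ^ (e l)) (fun i => C (ε i))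
    (fun i => card_support_linForm_le (c i) e)
    (fun i => (card_le_card (support_C_subset (ε i))).trans (by simp)) hG
  simpa [show T + 1 + 2 = T + 3 by ring] using h1

/-- **The quantifier swap `∀ K, ∃ a` of the registered stub `stub_waringCore` is a theorem**
(compare `realTauRefined_forall_m_exists_a` / `_forall_t_exists_a` in
`Theorems/RealTauRefined/Negative/LoadBearing.lean`, which are Descartes counts; this one is not —
the bound is uniform in `m`).  With `a = 5^K`: `(T+3)^(5^K) ≤ (K+T+2)^(5^K) ≤ 2^(a(m+1)) (K+T+2)^a`
for `K ≥ 1`.  The crux-grade content of `stub_waringCore` is therefore exactly the uniformity of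
`a` in `K`. [folklore] -/
theorem stub_waringCore_forall_K_exists_a :
    ∀ K : ℕ, ∃ a : ℕ, ∀ (m T : ℕ) (ε : Fin K → ℤˣ) (c : Fin K → Fin T → ℝ) (e : Fin T → ℕ),
      3 ≤ K → 3 ≤ m → m + 2 ≤ T → StrictMono e →
      (∑ i, C (((ε i : ℤ) : ℝ)) * (∑ l, C (c i l) * X ^ (e l)) ^ m) ≠ 0 →
        (∑ i, C (((ε i : ℤ) : ℝ)) * (∑ l, C (c i l) * X ^ (e l)) ^ m).roots.toFinset.card
          ≤ 2 ^ (a * (m + 1)) * (K + T + 2) ^ a := by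
  intro K
  refine ⟨5 ^ K, fun m T ε c e hK _hm _hT _he hG => ?_⟩
  have h1 := waring_card_roots_le_fixedK K m T (fun i => (((ε i : ℤ) : ℝ))) c e hG
  have h2 : (T + 3) ^ (5 ^ K) ≤ (K + T + 2) ^ (5 ^ K) := Nat.pow_le_pow_left (by omega) _
  have h3 : 1 ≤ 2 ^ (5 ^ K * (m + 1)) := Nat.one_le_two_pow
  calc _ ≤ (T + 3) ^ (5 ^ K) := h1
    _ ≤ (K + T + 2) ^ (5 ^ K) := h2
    _ = 1 * (K + T + 2) ^ (5 ^ K) := (one_mul _).symm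
    _ ≤ 2 ^ (5 ^ K * (m + 1)) * (K + T + 2) ^ (5 ^ K) := Nat.mul_le_mul_right _ h3

end Summit.ValiantsHypothesis.ValiantsHypothesis.Theorems.RealTauRealTauRefined
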